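import Literature.AnabelianGeometry.AbsoluteAnabelian.AbsTopIII.FrobeniusPictureMLFTelecoreProofs
import Literature.AnabelianGeometry.AbsoluteAnabelian.AbsTopIII.FrobeniusPictureMLFTelecoreNecessity
import HarnessLib

/-!
# [AbsTopIII] Cor. 3.6 (ii) as typed is EQUIVALENT to the coherence of `η_⋎` with `η_An` (under fully faithful `id_⋎`)

S. Mochizuki, *Topics in Absolute Anabelian Geometry III*, Cor. 3.6 (ii) pp. 79–80 (kurims manuscript
`paper:url-5493eb38cbb7`; bib key `MochizukiAbsTopIII2015`).  PROOF-ONLY file (abc-iut cell, seat abc-iut-w5-d061;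
RQ7 audit note N1 on `FrobeniusPictureMLFTelecoreProofs/Necessity`); no notion is declared.

Seat abc-iut-L4-t5 proved the typed statement `LogFrobeniusData.TelecoreStmt τ` from the coherence hypothesis
`hτ : id_⋎ (η_⋎)_x = e_{π_An(id_⋎ x)} ∘ (η_An)_{id_⋎ x}` for ALL `x : 𝒳₁` (`telecoreStmt_of_coherent`), and the converse
ON THE ESSENTIAL IMAGE of `φ_⋎` (`coherent_of_telecoreStmt`: the equation at `x = φ_⋎ a`).  Under the standing
hypothesis that `id_⋎` is fully faithful the two meet: `φ_⋎ ⋙ id_⋎ ≅ φ_An` with `φ_An` an equivalence makes every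
`x : 𝒳₁` isomorphic to some `φ_⋎ a` (`id_⋎` reflects the isomorphism `id_⋎(φ_⋎ a) ≅ φ_An a ≅ id_⋎ x`), and both sides
of the coherence equation are natural in `x`, so the equation transports along that isomorphism.  Hence
**`telecoreStmt_iff_coherent`**: for fully faithful `id_⋎`, `TelecoreStmt τ ↔ (∀ x, hτ x)` — the typed Cor. 3.6 (ii)
holds for EXACTLY the coherent telecore data (printed case `φ_⋎ = φ_An`, `e = 𝟙`, `η_⋎ = η_An`: coherent).
Refereed pre-IUT material; nothing here bears on [IUTchIII] Cor. 3.12 or takes a side.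
-/

namespace Literature.AnabelianGeometry.AbsoluteAnabelian

open _root_.CategoryTheory

universe u

namespace LogFrobeniusData

variable (Δ : LogFrobeniusData.{u}) (τ : Δ.TelecoreData)

/-- Naturality of the LEFT side of the coherence equation, `x ↦ id_⋎ (η_⋎)_x`, in `x : 𝒳₁`. [folklore] -/
private theorem coherence_lhs_naturality {y y' : Δ.X₁} (f : y ⟶ y') :
    Δ.toNexus.map ((((Δ.toNexus ⋙ Δ.XtoE) ⋙ Δ.κ) ⋙ τ.φ₁).map f) ≫ Δ.toNexus.map (τ.η₁.hom.app y') =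
      Δ.toNexus.map (τ.η₁.hom.app y) ≫ Δ.toNexus.map f := by
  rw [← Functor.map_comp, ← Functor.map_comp, τ.η₁.hom.naturality f]
  rfl

/-- Naturality of the RIGHT side of the coherence equation, `x ↦ e_{π_An(id_⋎ x)} ≫ (η_An)_{id_⋎ x}`. [folklore] -/
private theorem coherence_rhs_naturality {y y' : Δ.X₁} (f : y ⟶ y') :
    Δ.toNexus.map ((((Δ.toNexus ⋙ Δ.XtoE) ⋙ Δ.κ) ⋙ τ.φ₁).map f) ≫
        (τ.e.hom.app (Δ.κ.obj (Δ.XtoE.obj (Δ.toNexus.obj y'))) ≫ Δ.η.hom.app (Δ.toNexus.obj y')) =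
      (τ.e.hom.app (Δ.κ.obj (Δ.XtoE.obj (Δ.toNexus.obj y))) ≫ Δ.η.hom.app (Δ.toNexus.obj y)) ≫
        Δ.toNexus.map f := by
  have h1 : Δ.toNexus.map ((((Δ.toNexus ⋙ Δ.XtoE) ⋙ Δ.κ) ⋙ τ.φ₁).map f) ≫
      τ.e.hom.app (Δ.κ.obj (Δ.XtoE.obj (Δ.toNexus.obj y'))) =
      τ.e.hom.app (Δ.κ.obj (Δ.XtoE.obj (Δ.toNexus.obj y))) ≫
        Δ.φ.map (Δ.κ.map (Δ.XtoE.map (Δ.toNexus.map f))) :=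
    τ.e.hom.naturality (Δ.κ.map (Δ.XtoE.map (Δ.toNexus.map f)))
  have h2 : Δ.φ.map (Δ.κ.map (Δ.XtoE.map (Δ.toNexus.map f))) ≫ Δ.η.hom.app (Δ.toNexus.obj y') =
      Δ.η.hom.app (Δ.toNexus.obj y) ≫ Δ.toNexus.map f :=
    Δ.η.hom.naturality (Δ.toNexus.map f)
  have step1 := (reassoc_of% h1) (Δ.η.hom.app (Δ.toNexus.obj y'))
  have step2 := congrArg (fun t => τ.e.hom.app (Δ.κ.obj (Δ.XtoE.obj (Δ.toNexus.obj y))) ≫ t) h2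
  exact step1.trans ((Category.assoc _ _ _).trans (step2.trans (Category.assoc _ _ _).symm))

/-- **[AbsTopIII] Cor. 3.6 (ii) as typed ⟺ coherence**: for `Δ : LogFrobeniusData` with `id_⋎` fully faithful and
first-row telecore data `τ = (φ_⋎, e, η_⋎)`, the typed statement `TelecoreStmt τ` holds IF AND ONLY IF `η_⋎` is "the
isomorphism arising from `η_An`": `id_⋎ (η_⋎)_x = e_{π_An(id_⋎ x)} ∘ (η_An)_{id_⋎ x}` for every `x : 𝒳₁`
(⇐ `telecoreStmt_of_coherent`; ⇒ `coherent_of_telecoreStmt` on the essential image of `φ_⋎`, which is all of `𝒳₁`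
up to isomorphism since `φ_⋎ ⋙ id_⋎ ≅ φ_An` is an equivalence and `id_⋎` is fully faithful, plus naturality of both
sides). [cite: MochizukiAbsTopIII2015, Corollary 3.6 (ii) pp.79–80] -/
theorem telecoreStmt_iff_coherent (hν : Δ.toNexus.FullyFaithful) :
    Δ.TelecoreStmt τ ↔ ∀ x : Δ.X₁, Δ.toNexus.map (τ.η₁.hom.app x) =
      τ.e.hom.app (Δ.κ.obj (Δ.XtoE.obj (Δ.toNexus.obj x))) ≫ Δ.η.hom.app (Δ.toNexus.obj x) := by
  refine ⟨fun h x => ?_, fun hτ => Δ.telecoreStmt_of_coherent τ hν hτ⟩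
  haveI := Δ.φ_equiv
  -- `x ≅ φ_⋎ a` for `a := φ_An⁻¹ (id_⋎ x)`, reflected through the fully faithful `id_⋎`
  let a : Δ.A := Δ.φ.inv.obj (Δ.toNexus.obj x)
  let i₀ : Δ.toNexus.obj (τ.φ₁.obj a) ≅ Δ.toNexus.obj x :=
    τ.e.app a ≪≫ Δ.φ.asEquivalence.counitIso.app (Δ.toNexus.obj x)
  let i : τ.φ₁.obj a ≅ x := hν.preimageIso i₀
  have key := Δ.coherent_of_telecoreStmt τ h a
  have n1 := Δ.coherence_lhs_naturality τ i.hom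
  have n2 := Δ.coherence_rhs_naturality τ i.hom
  have e1 := n1.trans (congrArg (fun t => t ≫ Δ.toNexus.map i.hom) key)
  -- cancel the isomorphism `id_⋎(W(i))` on the left
  exact (cancel_epi (Δ.toNexus.map ((((Δ.toNexus ⋙ Δ.XtoE) ⋙ Δ.κ) ⋙ τ.φ₁).map i.hom))).mp (e1.trans n2.symm)

end LogFrobeniusData

end Literature.AnabelianGeometry.AbsoluteAnabelian
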